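import Literature.AlgebraicTopology.SingularHomology.CechDualityMayerVietoris
import Literature.AlgebraicTopology.SingularHomology.EulerCharacteristicTriple
import Mathlib.LinearAlgebra.FiniteDimensional.Lemmas
import Mathlib.RingTheory.Finiteness.Prod
import HarnessLib

/-!
# The Euler characteristic of Čech cohomology and its additivity over a union of two compact sets

E. H. Spanier, *Algebraic Topology* (1966), Ch. 4 §3 (Euler characteristic of a graded module
that is finitely generated and bounded; Thm. 14 / Ex. B: it is additive along exact sequences),
applied to the Mayer–Vietoris sequence of Čech cohomology (H. Miller, *Lectures on Algebraic
Topology* (2020), Cor. 35.8; Spanier Ch. 6 §1 Thm. 13): for compact `K₁`, `K₂` in a Hausdorff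
space whose Čech cohomology groups over a field `F` are finite-dimensional and bounded,
`χ̌(K₁ ∪ K₂) = χ̌(K₁) + χ̌(K₂) - χ̌(K₁ ∩ K₂)` with `χ̌(K) = Σ_p (-1)^p dim_F Ȟ^p(K)`.

For the tree's Čech cohomology `Cech F N K p = lim_→ H^p_X(U; N)` (`CechCohomology.lean`) and its
PROVED Mayer–Vietoris sequence (`Cech.mvRes`, `mvDiff`, `mvδ`, `mv_exact₁₂₃`,
`CechMayerVietoris.lean`; `Cech.mvRes_zero_injective`, `CechDualityMayerVietoris.lean`):

* `Cech.FinCech F N K n` — "`Ȟ^p(K; N)` is finite-dimensional for all `p` and zero for `p ≥ n`";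
* `Cech.euler F N K = Σ_p (-1)^p dim_F Ȟ^p(K; N)` — Mathlib's `GradedObject.eulerChar` of the
  graded module `p ↦ Ȟ^p(K; N)` (a `finsum`, junk value `0` for infinite support), equal to the
  truncated sum `eulerSum` under `FinCech` (`FinCech.euler_eq_eulerSum`);
* the rank bookkeeping along an ascending long exact sequence
  `0 → A 0 → B 0 → C 0 → A 1 → ⋯` of vector spaces (`AscendingLES`: finiteness and vanishing of
  the `A p` from those of `B p`, `C p`; the telescoping identity `eulerSum_eq`);
* **`FinCech.union`** and **`Cech.euler_union`**: for compact `K₁`, `K₂` with `FinCech` of bound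
  `n` on `K₁`, `K₂`, `K₁ ∩ K₂`, the union has `FinCech` of bound `n + 1` and
  `χ̌(K₁ ∪ K₂) = χ̌(K₁) + χ̌(K₂) - χ̌(K₁ ∩ K₂)`;
* **`Cech.euler_union₃`**: the inclusion–exclusion formula for three compact sets.

Everything is proved; no named facts. This is the bookkeeping half of the Euler-characteristic
count of a closed cover (used for trisected `4`-manifolds, Gay–Kirby 2016, Remark 2, in
`Literature/Topology/FourManifolds/`).

## References

* E. H. Spanier, *Algebraic Topology*, Springer 1981, Ch. 4 §3 (Thm. 14, Ex. B), Ch. 6 §1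
  (Thm. 13). [Spanier1981]
* H. Miller, *Lectures on Algebraic Topology*, World Scientific 2020, Cor. 35.8. [Miller2020]
-/

noncomputable section

open CategoryTheory

universe u v w

namespace Literature.AlgebraicTopology.SingularHomology

/-! ### Algebra: ranks along an ascending long exact sequence of vector spaces -/

/-- **An ascending long exact sequence of vector spaces** `0 → A 0 →f B 0 →g C 0 →d A 1 →f ⋯`:
three graded vector spaces with linear maps `f p : A p → B p`, `g p : B p → C p`,
`d p : C p → A (p + 1)`, exact at every `B p`, `C p`, `A (p + 1)`, and with `f 0` one-to-one (the
shape of the Mayer–Vietoris sequence in cohomology, Spanier 1966, Ch. 4 §3 / Ch. 6 §1 Thm. 13).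
[cite: Spanier1981, Ch. 4 §3 (Euler characteristic)] -/
structure AscendingLES (F : Type v) [Field F] where
  /-- the first graded space (`Ȟ^p(K₁ ∪ K₂)` in Mayer–Vietoris) -/
  A : ℕ → Type w
  /-- the second graded space (`Ȟ^p(K₁) × Ȟ^p(K₂)`) -/
  B : ℕ → Type w
  /-- the third graded space (`Ȟ^p(K₁ ∩ K₂)`) -/
  C : ℕ → Type w
  [acgA : ∀ p, AddCommGroup (A p)]
  [modA : ∀ p, Module F (A p)]
  [acgB : ∀ p, AddCommGroup (B p)]
  [modB : ∀ p, Module F (B p)]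
  [acgC : ∀ p, AddCommGroup (C p)]
  [modC : ∀ p, Module F (C p)]
  /-- `A p → B p` -/
  f : ∀ p, A p →ₗ[F] B p
  /-- `B p → C p` -/
  g : ∀ p, B p →ₗ[F] C p
  /-- the connecting map `C p → A (p + 1)` -/
  d : ∀ p, C p →ₗ[F] A (p + 1)
  /-- the sequence starts with `0 → A 0` -/
  injective_f_zero : Function.Injective (f 0)
  /-- exactness at `B p` -/
  exact_fg : ∀ p, Function.Exact (f p) (g p)
  /-- exactness at `C p` -/
  exact_gd : ∀ p, Function.Exact (g p) (d p)
  /-- exactness at `A (p + 1)` -/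
  exact_df : ∀ p, Function.Exact (d p) (f (p + 1))

namespace AscendingLES

attribute [instance] AscendingLES.acgA AscendingLES.modA AscendingLES.acgB AscendingLES.modB
  AscendingLES.acgC AscendingLES.modC

variable {F : Type v} [Field F] (L : AscendingLES.{v, w} F)

/-- **Finiteness of the first term**: if all `B p` and `C p` are finite-dimensional then so are
all `A p` (`A 0 ↪ B 0`; `A (p+1)` sits in the exact `C p → A (p+1) → B (p+1)`).
[cite: Spanier1981, Ch. 4 §3 (Euler characteristic)] -/
theorem finite_A (hB : ∀ p, Module.Finite F (L.B p)) (hC : ∀ p, Module.Finite F (L.C p)) :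
    ∀ p, Module.Finite F (L.A p) := by
  intro p
  cases p with
  | zero => exact Module.Finite.of_injective (L.f 0) L.injective_f_zero
  | succ p =>
    haveI := hC p
    haveI := hB (p + 1)
    haveI : IsNoetherian F (L.C p) := inferInstance
    haveI : IsNoetherian F (L.B (p + 1)) := inferInstance
    haveI : IsNoetherian F (L.A (p + 1)) :=
      isNoetherian_of_range_eq_ker (L.d p) (L.f (p + 1)) (L.exact_df p).linearMap_ker_eq.symm
    exact Module.IsNoetherian.finite F _

/-- **Vanishing of the first term**: if `C p = 0` and `B (p + 1) = 0` then `A (p + 1) = 0`.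
[cite: Spanier1981, Ch. 4 §3 (Euler characteristic)] -/
theorem subsingleton_A_succ {p : ℕ} (hC : Subsingleton (L.C p)) (hB : Subsingleton (L.B (p + 1))) :
    Subsingleton (L.A (p + 1)) := by
  refine ⟨fun x y => ?_⟩
  have hker : ∀ z : L.A (p + 1), z ∈ LinearMap.ker (L.f (p + 1)) := fun z => by
    rw [LinearMap.mem_ker]; exact Subsingleton.elim _ _
  have hx := hker x
  have hy := hker y
  rw [(L.exact_df p).linearMap_ker_eq, LinearMap.mem_range] at hx hy
  obtain ⟨a, rfl⟩ := hx
  obtain ⟨b, rfl⟩ := hy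
  rw [Subsingleton.elim a b]

section Rank

/-- The rank of the connecting map `d p`. [folklore] -/
abbrev rd (p : ℕ) : ℤ := Module.finrank F (LinearMap.range (L.d p))

/-- `dim A 0 = rk f₀` (`f₀` is one-to-one). [cite: Spanier1981, Ch. 4 §3 (Euler characteristic)] -/
theorem finrank_A_zero [Module.Finite F (L.A 0)] :
    (Module.finrank F (L.A 0) : ℤ) = Module.finrank F (LinearMap.range (L.f 0)) := by
  have h := (L.f 0).finrank_range_add_finrank_ker
  rw [LinearMap.ker_eq_bot.2 L.injective_f_zero, finrank_bot] at h
  omega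

/-- `dim A (p+1) = rk f_{p+1} + rk d_p` (rank–nullity and exactness at `A (p+1)`).
[cite: Spanier1981, Ch. 4 §3 (Euler characteristic)] -/
theorem finrank_A_succ (p : ℕ) [Module.Finite F (L.A (p + 1))] :
    (Module.finrank F (L.A (p + 1)) : ℤ) =
      Module.finrank F (LinearMap.range (L.f (p + 1))) + L.rd p := by
  have h := (L.f (p + 1)).finrank_range_add_finrank_ker
  rw [(L.exact_df p).linearMap_ker_eq] at h
  rw [rd]
  omega

/-- `dim B p = rk g_p + rk f_p` (rank–nullity and exactness at `B p`).
[cite: Spanier1981, Ch. 4 §3 (Euler characteristic)] -/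
theorem finrank_B (p : ℕ) [Module.Finite F (L.B p)] :
    (Module.finrank F (L.B p) : ℤ) =
      Module.finrank F (LinearMap.range (L.g p)) + Module.finrank F (LinearMap.range (L.f p)) := by
  have h := (L.g p).finrank_range_add_finrank_ker
  rw [(L.exact_fg p).linearMap_ker_eq] at h
  omega

/-- `dim C p = rk d_p + rk g_p` (rank–nullity and exactness at `C p`).
[cite: Spanier1981, Ch. 4 §3 (Euler characteristic)] -/
theorem finrank_C (p : ℕ) [Module.Finite F (L.C p)] :
    (Module.finrank F (L.C p) : ℤ) = L.rd p + Module.finrank F (LinearMap.range (L.g p)) := by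
  have h := (L.d p).finrank_range_add_finrank_ker
  rw [(L.exact_gd p).linearMap_ker_eq] at h
  rw [rd]
  omega

/-- **The telescoping identity**: `Σ_{p ≤ m} (-1)^p (dim A p - dim B p + dim C p) = (-1)^m rk d_m`
(Spanier 1966, Ch. 4 §3, proof of Thm. 14: the alternating sum of dimensions along an exact
sequence). [cite: Spanier1981, Ch. 4 §3, Thm. 14] -/
theorem eulerSum_eq [∀ p, Module.Finite F (L.A p)] [∀ p, Module.Finite F (L.B p)]
    [∀ p, Module.Finite F (L.C p)] (m : ℕ) :
    ∑ p ∈ Finset.range (m + 1), (-1 : ℤ) ^ p *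
        ((Module.finrank F (L.A p) : ℤ) - Module.finrank F (L.B p) + Module.finrank F (L.C p)) =
      (-1 : ℤ) ^ m * L.rd m := by
  induction m with
  | zero =>
    rw [Finset.sum_range_one, L.finrank_A_zero, L.finrank_B 0, L.finrank_C 0]
    ring
  | succ m ih =>
    rw [Finset.sum_range_succ, ih, L.finrank_A_succ m, L.finrank_B (m + 1), L.finrank_C (m + 1),
      pow_succ]
    ring

/-- **Additivity of the truncated Euler characteristic**: if `C m = 0` then
`Σ_{p ≤ m} (-1)^p dim A p = Σ_{p ≤ m} (-1)^p dim B p - Σ_{p ≤ m} (-1)^p dim C p`.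
[cite: Spanier1981, Ch. 4 §3, Thm. 14] -/
theorem eulerSum_A_eq [∀ p, Module.Finite F (L.A p)] [∀ p, Module.Finite F (L.B p)]
    [∀ p, Module.Finite F (L.C p)] (m : ℕ) (hm : Subsingleton (L.C m)) :
    ∑ p ∈ Finset.range (m + 1), (-1 : ℤ) ^ p * (Module.finrank F (L.A p) : ℤ) =
      ∑ p ∈ Finset.range (m + 1), (-1 : ℤ) ^ p * (Module.finrank F (L.B p) : ℤ) -
        ∑ p ∈ Finset.range (m + 1), (-1 : ℤ) ^ p * (Module.finrank F (L.C p) : ℤ) := by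
  have h := L.eulerSum_eq m
  have hd : L.rd m = 0 := by
    rw [rd]
    have : LinearMap.range (L.d m) = ⊥ := by
      rw [LinearMap.range_eq_bot]
      ext x
      rw [Subsingleton.elim x 0, map_zero, LinearMap.zero_apply]
    rw [this, finrank_bot, Nat.cast_zero]
  rw [hd, mul_zero] at h
  have hsplit : ∑ p ∈ Finset.range (m + 1), (-1 : ℤ) ^ p *
      ((Module.finrank F (L.A p) : ℤ) - Module.finrank F (L.B p) + Module.finrank F (L.C p)) =
      ∑ p ∈ Finset.range (m + 1), (-1 : ℤ) ^ p * (Module.finrank F (L.A p) : ℤ) -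
        ∑ p ∈ Finset.range (m + 1), (-1 : ℤ) ^ p * (Module.finrank F (L.B p) : ℤ) +
          ∑ p ∈ Finset.range (m + 1), (-1 : ℤ) ^ p * (Module.finrank F (L.C p) : ℤ) := by
    rw [← Finset.sum_sub_distrib, ← Finset.sum_add_distrib]
    exact Finset.sum_congr rfl fun p _ => by ring
  rw [hsplit] at h
  linarith

end Rank

end AscendingLES

/-! ### Finite, bounded Čech cohomology and its Euler characteristic -/

variable (F : Type v) [Field F] (N : ModuleCat.{max u v} F) {X : Type u} [TopologicalSpace X]

namespace Cech

/-- **`FinCech F N K n`: the Čech cohomology `Ȟ^p(K; N)` is finite-dimensional over `F` for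
every `p` and vanishes for `p ≥ n`** — the hypothesis under which `χ̌(K) = Σ (-1)^p dim Ȟ^p(K)`
is a finite sum (Spanier 1966, Ch. 4 §3, before Thm. 14). [cite: Spanier1981, Ch. 4 §3 (Euler characteristic)] -/
structure FinCech (K : Set X) (n : ℕ) : Prop where
  /-- every `Ȟ^p(K; N)` is finite-dimensional -/
  finite : ∀ p, Module.Finite F (Cech F N K p)
  /-- `Ȟ^p(K; N) = 0` for `p ≥ n` -/
  subsingleton : ∀ p, n ≤ p → Subsingleton (Cech F N K p)

/-- **The Euler characteristic of Čech cohomology** `χ̌(K) = Σ_p (-1)^p dim_F Ȟ^p(K; N)`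
(Spanier 1966, Ch. 4 §3), as Mathlib's `GradedObject.eulerChar (ComplexShape.down ℕ)` of the
graded module `p ↦ Ȟ^p(K; N)` — a `finsum`, with junk value `0` when infinitely many
dimensions are non-zero; under `FinCech F N K n` it is the finite sum below `n`
(`FinCech.euler_eq_eulerSum`). [cite: Spanier1981, Ch. 4 §3 (Euler characteristic)] -/
def euler (K : Set X) : ℤ :=
  GradedObject.eulerChar (ComplexShape.down ℕ) (fun p => ModuleCat.of F (Cech F N K p))

variable {F N}

/-- Enlarging the bound. [folklore] -/
theorem FinCech.mono {K : Set X} {n m : ℕ} (h : FinCech F N K n) (hnm : n ≤ m) : FinCech F N K m :=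
  ⟨h.finite, fun p hp => h.subsingleton p (hnm.trans hp)⟩

/-- Under `FinCech F N K n`: `χ̌(K) = Σ_{p<n} (-1)^p dim_F Ȟ^p(K; N)`.
[cite: Spanier1981, Ch. 4 §3 (Euler characteristic)] -/
theorem FinCech.euler_eq_eulerSum {K : Set X} {n : ℕ} (h : FinCech F N K n) :
    euler F N K = ∑ p ∈ Finset.range n, (-1 : ℤ) ^ p * (Module.finrank F (Cech F N K p) : ℤ) := by
  rw [euler, eulerChar_eq_eulerSum (R := F) (N := n) fun p hp => ?_]
  · rfl
  · haveI := h.subsingleton p hp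
    exact ModuleCat.isZero_of_subsingleton _

/-- **Transport of `FinCech` along linear equivalences**: if every `Ȟ^p(K; N)` is linearly
equivalent to a finite-dimensional space `V p` vanishing for `p ≥ n` (e.g. the singular
cohomology of `↥K`), then `FinCech F N K n`. [folklore] -/
theorem FinCech.of_linearEquiv {K : Set X} {n : ℕ} {V : ℕ → Type w} [∀ p, AddCommGroup (V p)]
    [∀ p, Module F (V p)] (e : ∀ p, Cech F N K p ≃ₗ[F] V p) (hfin : ∀ p, Module.Finite F (V p))
    (hzero : ∀ p, n ≤ p → Subsingleton (V p)) : FinCech F N K n :=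
  ⟨fun p => by haveI := hfin p; exact Module.Finite.equiv (e p).symm,
   fun p hp => by haveI := hzero p hp; exact (e p).injective.subsingleton⟩

/-- **`χ̌(K)` computed through linear equivalences**: under `FinCech F N K n` and
`Ȟ^p(K; N) ≃ V p`, `χ̌(K) = Σ_{p<n} (-1)^p dim_F (V p)`. [folklore] -/
theorem FinCech.euler_eq_sum_of_linearEquiv {K : Set X} {n : ℕ} (h : FinCech F N K n)
    {V : ℕ → Type w} [∀ p, AddCommGroup (V p)] [∀ p, Module F (V p)]
    (e : ∀ p, Cech F N K p ≃ₗ[F] V p) :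
    euler F N K = ∑ p ∈ Finset.range n, (-1 : ℤ) ^ p * (Module.finrank F (V p) : ℤ) := by
  rw [h.euler_eq_eulerSum]
  exact Finset.sum_congr rfl fun p _ => by rw [(e p).finrank_eq]

/-! ### The Mayer–Vietoris sequence as an ascending long exact sequence -/

variable [T2Space X] {K₁ K₂ : Set X}

/-- The Čech Mayer–Vietoris sequence of compact `K₁`, `K₂` in a Hausdorff space, packaged as an
`AscendingLES` (Miller 2020, Cor. 35.8: `0 → Ȟ⁰(K₁ ∪ K₂) → Ȟ⁰(K₁) ⊕ Ȟ⁰(K₂) → Ȟ⁰(K₁ ∩ K₂) → Ȟ¹(K₁ ∪ K₂) → ⋯`).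
[cite: Miller2020, Cor. 35.8] -/
def mvLES (hK₁ : IsCompact K₁) (hK₂ : IsCompact K₂) : AscendingLES.{v, max u v} F where
  A p := Cech F N (K₁ ∪ K₂) p
  B p := Cech F N K₁ p × Cech F N K₂ p
  C p := Cech F N (K₁ ∩ K₂) p
  f p := mvRes F N K₁ K₂ p
  g p := mvDiff F N K₁ K₂ p
  d p := mvδ (N := N) hK₁ hK₂ p
  injective_f_zero := mvRes_zero_injective K₁ K₂
  exact_fg p := mv_exact₂ hK₁ hK₂ p
  exact_gd p := mv_exact₃ hK₁ hK₂ p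
  exact_df p := mv_exact₁ hK₁ hK₂ p

/-- **Finiteness and vanishing for a union** (Spanier 1966, Ch. 6 §1 Thm. 13 with Ch. 4 §3):
if `Ȟ^•(K₁)`, `Ȟ^•(K₂)`, `Ȟ^•(K₁ ∩ K₂)` are finite-dimensional and vanish from degree `n` on,
then `Ȟ^•(K₁ ∪ K₂)` is finite-dimensional and vanishes from degree `n + 1` on.
[cite: Spanier1981, Ch. 6 §1, Thm. 13] -/
theorem FinCech.union (hK₁ : IsCompact K₁) (hK₂ : IsCompact K₂) {n : ℕ} (h₁ : FinCech F N K₁ n)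
    (h₂ : FinCech F N K₂ n) (h₁₂ : FinCech F N (K₁ ∩ K₂) n) : FinCech F N (K₁ ∪ K₂) (n + 1) := by
  have hB : ∀ p, Module.Finite F ((mvLES (F := F) (N := N) hK₁ hK₂).B p) := fun p => by
    haveI := h₁.finite p; haveI := h₂.finite p
    exact Module.Finite.prod
  refine ⟨(mvLES hK₁ hK₂).finite_A hB h₁₂.finite, fun p hp => ?_⟩
  obtain ⟨q, rfl⟩ := Nat.exists_eq_add_of_le' (Nat.one_le_iff_ne_zero.2 (by omega) : 1 ≤ p)
  haveI := h₁.subsingleton (q + 1) (by omega)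
  haveI := h₂.subsingleton (q + 1) (by omega)
  exact (mvLES (F := F) (N := N) hK₁ hK₂).subsingleton_A_succ (h₁₂.subsingleton q (by omega))
    (inferInstanceAs (Subsingleton (Cech F N K₁ (q + 1) × Cech F N K₂ (q + 1))))

/-- **Additivity of the Čech Euler characteristic** (Spanier 1966, Ch. 4 §3 Thm. 14 / Ex. B
applied to the Mayer–Vietoris sequence, Miller 2020, Cor. 35.8): for compact `K₁`, `K₂` in a
Hausdorff space with finite-dimensional, bounded Čech cohomology of `K₁`, `K₂`, `K₁ ∩ K₂`,
`χ̌(K₁ ∪ K₂) = χ̌(K₁) + χ̌(K₂) - χ̌(K₁ ∩ K₂)`. [cite: Spanier1981, Ch. 4 §3, Thm. 14] -/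
theorem euler_union (hK₁ : IsCompact K₁) (hK₂ : IsCompact K₂) {n : ℕ} (h₁ : FinCech F N K₁ n)
    (h₂ : FinCech F N K₂ n) (h₁₂ : FinCech F N (K₁ ∩ K₂) n) :
    euler F N (K₁ ∪ K₂) = euler F N K₁ + euler F N K₂ - euler F N (K₁ ∩ K₂) := by
  haveI hB : ∀ p, Module.Finite F ((mvLES (F := F) (N := N) hK₁ hK₂).B p) := fun p => by
    haveI := h₁.finite p; haveI := h₂.finite p
    exact Module.Finite.prod
  haveI hC : ∀ p, Module.Finite F ((mvLES (F := F) (N := N) hK₁ hK₂).C p) := h₁₂.finite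
  haveI hA : ∀ p, Module.Finite F ((mvLES (F := F) (N := N) hK₁ hK₂).A p) :=
    (mvLES hK₁ hK₂).finite_A hB hC
  have key := (mvLES (F := F) (N := N) hK₁ hK₂).eulerSum_A_eq n (h₁₂.subsingleton n le_rfl)
  have hBsum : ∑ p ∈ Finset.range (n + 1), (-1 : ℤ) ^ p *
      (Module.finrank F ((mvLES (F := F) (N := N) hK₁ hK₂).B p) : ℤ) =
      ∑ p ∈ Finset.range (n + 1), (-1 : ℤ) ^ p * (Module.finrank F (Cech F N K₁ p) : ℤ) +
        ∑ p ∈ Finset.range (n + 1), (-1 : ℤ) ^ p * (Module.finrank F (Cech F N K₂ p) : ℤ) := by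
    rw [← Finset.sum_add_distrib]
    refine Finset.sum_congr rfl fun p _ => ?_
    haveI := h₁.finite p; haveI := h₂.finite p
    rw [show (Module.finrank F ((mvLES (F := F) (N := N) hK₁ hK₂).B p) : ℤ) =
      Module.finrank F (Cech F N K₁ p × Cech F N K₂ p) from rfl, Module.finrank_prod]
    push_cast
    ring
  have hAsum : ∑ p ∈ Finset.range (n + 1), (-1 : ℤ) ^ p *
      (Module.finrank F ((mvLES (F := F) (N := N) hK₁ hK₂).A p) : ℤ) =
      ∑ p ∈ Finset.range (n + 1), (-1 : ℤ) ^ p * (Module.finrank F (Cech F N (K₁ ∪ K₂) p) : ℤ) :=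
    rfl
  have hCsum : ∑ p ∈ Finset.range (n + 1), (-1 : ℤ) ^ p *
      (Module.finrank F ((mvLES (F := F) (N := N) hK₁ hK₂).C p) : ℤ) =
      ∑ p ∈ Finset.range (n + 1), (-1 : ℤ) ^ p * (Module.finrank F (Cech F N (K₁ ∩ K₂) p) : ℤ) :=
    rfl
  have hn : n ≤ n + 1 := Nat.le_add_right n 1
  rw [(h₁.union hK₁ hK₂ h₂ h₁₂).euler_eq_eulerSum, (h₁.mono hn).euler_eq_eulerSum,
    (h₂.mono hn).euler_eq_eulerSum, (h₁₂.mono hn).euler_eq_eulerSum, ← hAsum, key, hBsum, hCsum]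

/-- **Inclusion–exclusion for three compact sets**: with finite-dimensional, bounded Čech
cohomology of the three sets, of their pairwise intersections and of the triple intersection,
`χ̌(S₀ ∪ S₁ ∪ S₂) = Σᵢ χ̌(Sᵢ) - Σ_{i<j} χ̌(Sᵢ ∩ Sⱼ) + χ̌(S₀ ∩ S₁ ∩ S₂)`, and the Čech cohomology
of the union is finite-dimensional and bounded by `n + 2` (two applications of `euler_union`).
[cite: Spanier1981, Ch. 4 §3, Thm. 14] -/
theorem euler_union₃ {S₀ S₁ S₂ : Set X} (h₀ : IsCompact S₀) (h₁ : IsCompact S₁)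
    (h₂ : IsCompact S₂) {n : ℕ} (f₀ : FinCech F N S₀ n) (f₁ : FinCech F N S₁ n)
    (f₂ : FinCech F N S₂ n) (f₀₁ : FinCech F N (S₀ ∩ S₁) n) (f₀₂ : FinCech F N (S₀ ∩ S₂) n)
    (f₁₂ : FinCech F N (S₁ ∩ S₂) n) (f₀₁₂ : FinCech F N (S₀ ∩ S₁ ∩ S₂) n) :
    FinCech F N (S₀ ∪ S₁ ∪ S₂) (n + 2) ∧
      euler F N (S₀ ∪ S₁ ∪ S₂) =
        euler F N S₀ + euler F N S₁ + euler F N S₂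
          - euler F N (S₀ ∩ S₁) - euler F N (S₀ ∩ S₂) - euler F N (S₁ ∩ S₂)
          + euler F N (S₀ ∩ S₁ ∩ S₂) := by
  -- `(S₀ ∪ S₁) ∩ S₂ = (S₀ ∩ S₂) ∪ (S₁ ∩ S₂)`, whose two pieces meet in `S₀ ∩ S₁ ∩ S₂`
  have hI : (S₀ ∪ S₁) ∩ S₂ = (S₀ ∩ S₂) ∪ (S₁ ∩ S₂) := Set.union_inter_distrib_right S₀ S₁ S₂
  have hII : (S₀ ∩ S₂) ∩ (S₁ ∩ S₂) = S₀ ∩ S₁ ∩ S₂ := by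
    ext x; simp only [Set.mem_inter_iff]; tauto
  have c₀₂ : IsCompact (S₀ ∩ S₂) := h₀.inter_right h₂.isClosed
  have c₁₂ : IsCompact (S₁ ∩ S₂) := h₁.inter_right h₂.isClosed
  have f₀₁₂' : FinCech F N ((S₀ ∩ S₂) ∩ (S₁ ∩ S₂)) n := by rw [hII]; exact f₀₁₂
  -- the pairwise pieces `S₀ ∩ S₂`, `S₁ ∩ S₂`
  have fI : FinCech F N ((S₀ ∪ S₁) ∩ S₂) (n + 1) := by
    rw [hI]; exact f₀₂.union c₀₂ c₁₂ f₁₂ f₀₁₂'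
  have eI : euler F N ((S₀ ∪ S₁) ∩ S₂) =
      euler F N (S₀ ∩ S₂) + euler F N (S₁ ∩ S₂) - euler F N (S₀ ∩ S₁ ∩ S₂) := by
    rw [hI, euler_union c₀₂ c₁₂ f₀₂ f₁₂ f₀₁₂', hII]
  -- `S₀ ∪ S₁`
  have fU : FinCech F N (S₀ ∪ S₁) (n + 1) := f₀.union h₀ h₁ f₁ f₀₁
  have eU : euler F N (S₀ ∪ S₁) = euler F N S₀ + euler F N S₁ - euler F N (S₀ ∩ S₁) :=
    euler_union h₀ h₁ f₀ f₁ f₀₁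
  -- `(S₀ ∪ S₁) ∪ S₂`
  refine ⟨fU.union (h₀.union h₁) h₂ (f₂.mono (Nat.le_add_right n 1)) fI, ?_⟩
  rw [euler_union (h₀.union h₁) h₂ fU (f₂.mono (Nat.le_add_right n 1)) fI, eU, eI]
  ring

end Cech

end Literature.AlgebraicTopology.SingularHomology
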